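import Mathlib
import HarnessLib

/-!
# Route `UnitScaleTilt`, crux K1 «MinimiserStabilityRegPr» (stmt-QuantumFields-19200), route-R [RP] curved, the fibre core's residual (B7) —
# THE LEVEL-MASS INDUCTION (real sequences): the triangular system `x_i ≤ ρⁱe_ix₀ + D·λ_i + e_iS_i + D·Σ_{j<i}C·e_jS_j`,
# `S_j = Σ_{l<j}ρ^{j−1−l}·260μ_lC₁·x_l`, with sources `260μ_lC₁ ≤ θρ^{2(k−l)}` and gauge data `ρⁱλ_i ≤ B`, closes as `ρⁱx_i ≤ Eρ^{2i}x₀ + Γ`,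
# `Γ = 2(DB + θEK₀·Ex₀ρ^{2k+1}/(1−ρ²))`, `K₀ = 1 + DCρ/(1−ρ)`, once `θEK₀ρ³/(1−ρ⁴) ≤ 1/2` — and then `ρᵏ(e_kS_k + DΣ_{j<k}Ce_jS_j) ≤ DB + 2θEK₀·Ex₀ρ^{2k+1}/(1−ρ²)`

Cell `ym3-torus`, D-0154 (3c) twin-width seat `ym-routeR-w3` (gen 2); the scalar engine behind the T³ sequel of ✓ `…Prop7FibreLevelMass`.  THEOREMS ONLY (0 `def`, 0 `sorry`);
`--supports stmt-QuantumFields-19200`, count-neutral.  YM₃ on T³ is a ladder rung (R3), not the Clay problem; nothing here claims the stub, the crux, d = 4 or the mass gap.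

THE POINT.  ✓ `Prop7FibreLevelMass.sqrt_sum_normSq_levelRatio_le` bounds the `ℓ²` mass `x_i = ‖Y_i‖_{ℓ²}` of the level-`i` ratio field by `ρⁱE_i‖Y‖ + 2√d‖Λ_i‖ + E_iS_i +
2√dΣ_{j<i}C_CM E_jS_j`, the `S_j` seeing only the masses at levels `l < j` through the sup-type coefficients `260μ_lC₁`.  With the (B6) shape `μ_l ≤ Mu·L^{l−k}` (so
`260μ_lC₁ ≤ θρ^{2(k−l)}` at d = 3, `ρ = L^{−1/2}`) and the (R-B) shape `‖Λ_i‖ ≤ ρ^{−i}B`, the two-shape ansatz `ρⁱx_i ≤ Eρ^{2i}x₀ + Γ` propagates: the `Eρ^{2l}x₀` part of an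
old mass enters `ρʲS_j` as `θEx₀ρ^{2k+1}Σ_{m<j}ρ^{2m} ≤ θEx₀ρ^{2k+1}/(1−ρ²)` (it KEEPS the factor `ρ^{2k} = ℓ⁻¹` — this is what makes `96ℓ⁻¹Z_Q` absorbable by `½ℓ⁻²Σ‖Y‖²`), the `Γ`
part as `θΓρ^{2(k−j)+3}Σ_{m<j}ρ^{4m} ≤ θΓρ³/(1−ρ⁴)`; the gauge double sum costs the factor `K₀ = 1 + DCρ/(1−ρ)` (`Σ_{j<i}ρ^{i−j} ≤ ρ/(1−ρ)`).  Pure real analysis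
(finite geometric sums, strong induction); no lattice object appears.

WHAT IS PROVED (ns `…Theorems.Prop7FibreLevelMassInduction`).
* §1 `geom_sum_reflect_le` — `Σ_{m<n}r^{n−1−m} ≤ 1/(1−r)`.
* §2 ★★ `levelMass_induction` — the title (both conclusions).
HONEST SCOPE.  Elementary; the constants are explicit and k-independent by inspection (`ρ^{2k+1}` is the only k-dependence, a DECAY).

References: T. Bałaban, CMP 98 (1985) 17–51 [Balaban1985Averaging] (Prop. 3 (122)–(126) p.36); CMP 95 (1984) 17–40 [Balaban1984PropagatorsI] ((1.18)–(1.20) pp.19–20).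
-/

set_option autoImplicit false

noncomputable section

open scoped BigOperators

namespace Summit.QuantumFields.YangMills.Theorems.Prop7FibreLevelMassInduction

/-! ## §1 Finite geometric sums -/

/-- The reflected geometric sum `Σ_{m<n} r^{n−1−m} ≤ 1/(1 − r)` for `0 ≤ r < 1` (the unreflected form is the tree's
`Literature.Barriers.NavierStokesRegularity.Dyadic.geom_sum_le_inv`; three lines, re-derived here to keep the import list physical). [folklore] -/
theorem geom_sum_reflect_le {r : ℝ} (hr0 : 0 ≤ r) (hr1 : r < 1) (n : ℕ) :
    ∑ m ∈ Finset.range n, r ^ (n - 1 - m) ≤ 1 / (1 - r) := by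
  have h := Finset.sum_range_reflect (fun m => r ^ m) n
  rw [h]
  have h1 : 0 < 1 - r := by linarith
  rw [le_div_iff₀ h1, geom_sum_mul_neg r n]
  have : 0 ≤ r ^ n := pow_nonneg hr0 n
  linarith

/-! ## §2 ★★ The level-mass induction -/

/-- ★★ **THE LEVEL-MASS INDUCTION.**  Reals `0 < ρ < 1`, `θ, E, C, D, B, C₁, x₀ ≥ 0`; sequences `x ≥ 0` (the masses), `e` (`0 ≤ e j ≤ E`, the level
exponentials), `lam` (`0 ≤ lam i`, `ρⁱ·lam i ≤ B`, the coarse gauge functions), `μ` (`0 ≤ μ l`, `260·μ_l·C₁ ≤ θ·ρ^{2(k−l)}`, the two-block sups) and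
`S j = Σ_{l<j}ρ^{j−1−l}·260·μ_l·C₁·x_l`; the level rows `x i ≤ ρⁱe_ix₀ + D·lam i + (e_iS_i + D·Σ_{j<i}C·e_jS_j)` for `i ≤ k`; smallness `θ·E·K₀·(ρ³/(1−ρ⁴)) ≤ 1/2` with
`K₀ = 1 + D·C·(ρ/(1−ρ))`.  THEN, with `Γ = 2·(D·B + θ·E·K₀·(E·x₀·ρ^{2k+1}/(1−ρ²)))`:  (1) `ρⁱ·x i ≤ E·ρ^{2i}·x₀ + Γ` for every `i ≤ k`;
(2) `ρᵏ·(e_kS_k + D·Σ_{j<k}C·e_jS_j) ≤ D·B + 2·θ·E·K₀·(E·x₀·ρ^{2k+1}/(1−ρ²))`. [folklore] -/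
theorem levelMass_induction {ρ θ E C D B C₁ x₀ : ℝ} (hρ0 : 0 < ρ) (hρ1 : ρ < 1) (hθ : 0 ≤ θ) (hE : 0 ≤ E) (hC : 0 ≤ C) (hD : 0 ≤ D)
    (hB : 0 ≤ B) (hC₁ : 0 ≤ C₁) (hx₀ : 0 ≤ x₀) (k : ℕ) (x e lam μ S : ℕ → ℝ)
    (hx : ∀ i, 0 ≤ x i)
    (he : ∀ j ≤ k, 0 ≤ e j ∧ e j ≤ E)
    (hlam : ∀ i ≤ k, 0 ≤ lam i ∧ ρ ^ i * lam i ≤ B)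
    (hμ : ∀ l < k, 0 ≤ μ l ∧ 260 * (μ l * C₁) ≤ θ * ρ ^ (2 * (k - l)))
    (hS : ∀ j, S j = ∑ l ∈ Finset.range j, ρ ^ (j - 1 - l) * (260 * (μ l * (C₁ * x l))))
    (hrec : ∀ i ≤ k, x i ≤ ρ ^ i * e i * x₀ + D * lam i + (e i * S i + D * ∑ j ∈ Finset.range i, C * (e j * S j)))
    (hsmall : θ * E * (1 + D * C * (ρ / (1 - ρ))) * (ρ ^ 3 / (1 - ρ ^ 4)) ≤ 1 / 2) :
    (∀ i ≤ k, ρ ^ i * x i ≤ E * ρ ^ (2 * i) * x₀ + 2 * (D * B + θ * E * (1 + D * C * (ρ / (1 - ρ))) * (E * x₀ * ρ ^ (2 * k + 1) / (1 - ρ ^ 2)))) ∧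
    ρ ^ k * (e k * S k + D * ∑ j ∈ Finset.range k, C * (e j * S j))
      ≤ D * B + 2 * (θ * E * (1 + D * C * (ρ / (1 - ρ))) * (E * x₀ * ρ ^ (2 * k + 1) / (1 - ρ ^ 2))) := by
  -- letters (plain `have`-abbreviations through equalities, no `set`)
  have hρle1 : ρ ≤ 1 := hρ1.le
  have h1ρ : 0 < 1 - ρ := by linarith
  have hρ2lt : ρ ^ 2 < 1 := by nlinarith
  have hρ4lt : ρ ^ 4 < 1 := by nlinarith
  have h1ρ2 : 0 < 1 - ρ ^ 2 := by linarith
  have h1ρ4 : 0 < 1 - ρ ^ 4 := by linarith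
  have hK₀ : 1 ≤ 1 + D * C * (ρ / (1 - ρ)) := by
    have : 0 ≤ D * C * (ρ / (1 - ρ)) := by positivity
    linarith
  have hK₀0 : 0 ≤ 1 + D * C * (ρ / (1 - ρ)) := by linarith
  have hq0 : 0 ≤ ρ ^ 3 / (1 - ρ ^ 4) := by positivity
  have hP0 : 0 ≤ E * x₀ * ρ ^ (2 * k + 1) / (1 - ρ ^ 2) := by positivity
  have hΓ0 : 0 ≤ 2 * (D * B + θ * E * (1 + D * C * (ρ / (1 - ρ))) * (E * x₀ * ρ ^ (2 * k + 1) / (1 - ρ ^ 2))) := by positivity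
  -- the sources are nonnegative
  have hS0 : ∀ j ≤ k, 0 ≤ S j := by
    intro j hj
    rw [hS j]
    refine Finset.sum_nonneg fun l hl => ?_
    have hlk : l < k := lt_of_lt_of_le (Finset.mem_range.mp hl) hj
    have := (hμ l hlk).1
    have := hx l
    positivity
  -- ★ the key estimate: an old-mass bound at all levels `l < j` controls `ρʲ·S_j`
  have key : ∀ j ≤ k, (∀ l < j, ρ ^ l * x l ≤ E * ρ ^ (2 * l) * x₀ + 2 * (D * B + θ * E * (1 + D * C * (ρ / (1 - ρ))) * (E * x₀ * ρ ^ (2 * k + 1) / (1 - ρ ^ 2)))) →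
      ρ ^ j * S j ≤ θ * (E * x₀ * ρ ^ (2 * k + 1) / (1 - ρ ^ 2)
        + 2 * (D * B + θ * E * (1 + D * C * (ρ / (1 - ρ))) * (E * x₀ * ρ ^ (2 * k + 1) / (1 - ρ ^ 2))) * (ρ ^ 3 / (1 - ρ ^ 4))) := by
    intro j hj IH
    rw [hS j, Finset.mul_sum]
    have hterm : ∀ l ∈ Finset.range j, ρ ^ j * (ρ ^ (j - 1 - l) * (260 * (μ l * (C₁ * x l))))
        ≤ θ * E * x₀ * ρ ^ (2 * k + 1) * (ρ ^ 2) ^ (j - 1 - l)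
          + θ * (2 * (D * B + θ * E * (1 + D * C * (ρ / (1 - ρ))) * (E * x₀ * ρ ^ (2 * k + 1) / (1 - ρ ^ 2)))) * ρ ^ 3 * (ρ ^ 4) ^ (j - 1 - l) := by
      intro l hl
      have hlj : l < j := Finset.mem_range.mp hl
      have hlk : l < k := lt_of_lt_of_le hlj hj
      obtain ⟨hμ0, hμθ⟩ := hμ l hlk
      have hIH := IH l hlj
      have hxl := hx l
      have e1 : ρ ^ j * ρ ^ (j - 1 - l) = ρ ^ (2 * (j - 1 - l) + 1) * ρ ^ l := by
        rw [← pow_add, ← pow_add]; congr 1; omega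
      have hp0 : 0 ≤ ρ ^ (2 * (j - 1 - l) + 1) := pow_nonneg hρ0.le _
      have hμC0 : 0 ≤ 260 * (μ l * C₁) := by positivity
      have hρlx : 0 ≤ ρ ^ l * x l := mul_nonneg (pow_nonneg hρ0.le _) hxl
      have hρ3 : ρ ^ (2 * (k - j) + 3) ≤ ρ ^ 3 := pow_le_pow_of_le_one hρ0.le hρle1 (by omega)
      calc ρ ^ j * (ρ ^ (j - 1 - l) * (260 * (μ l * (C₁ * x l))))
          = (ρ ^ j * ρ ^ (j - 1 - l)) * (260 * (μ l * C₁)) * x l := by ring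
        _ = ρ ^ (2 * (j - 1 - l) + 1) * (260 * (μ l * C₁)) * (ρ ^ l * x l) := by rw [e1]; ring
        _ ≤ ρ ^ (2 * (j - 1 - l) + 1) * (θ * ρ ^ (2 * (k - l)))
              * (E * ρ ^ (2 * l) * x₀ + 2 * (D * B + θ * E * (1 + D * C * (ρ / (1 - ρ))) * (E * x₀ * ρ ^ (2 * k + 1) / (1 - ρ ^ 2)))) :=
            mul_le_mul (mul_le_mul_of_nonneg_left hμθ hp0) hIH hρlx (mul_nonneg hp0 (mul_nonneg hθ (pow_nonneg hρ0.le _)))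
        _ = θ * E * x₀ * (ρ ^ (2 * (j - 1 - l) + 1) * ρ ^ (2 * (k - l)) * ρ ^ (2 * l))
              + θ * (2 * (D * B + θ * E * (1 + D * C * (ρ / (1 - ρ))) * (E * x₀ * ρ ^ (2 * k + 1) / (1 - ρ ^ 2))))
                * (ρ ^ (2 * (j - 1 - l) + 1) * ρ ^ (2 * (k - l))) := by ring
        _ = θ * E * x₀ * (ρ ^ (2 * k + 1) * (ρ ^ 2) ^ (j - 1 - l))
              + θ * (2 * (D * B + θ * E * (1 + D * C * (ρ / (1 - ρ))) * (E * x₀ * ρ ^ (2 * k + 1) / (1 - ρ ^ 2))))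
                * (ρ ^ (2 * (k - j) + 3) * (ρ ^ 4) ^ (j - 1 - l)) := by
            congr 2
            · rw [← pow_mul, ← pow_add, ← pow_add, ← pow_add]; congr 1; omega
            · rw [← pow_mul, ← pow_add, ← pow_add]; congr 1; omega
        _ ≤ θ * E * x₀ * (ρ ^ (2 * k + 1) * (ρ ^ 2) ^ (j - 1 - l))
              + θ * (2 * (D * B + θ * E * (1 + D * C * (ρ / (1 - ρ))) * (E * x₀ * ρ ^ (2 * k + 1) / (1 - ρ ^ 2))))
                * (ρ ^ 3 * (ρ ^ 4) ^ (j - 1 - l)) := by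
            have h4 : 0 ≤ (ρ ^ 4) ^ (j - 1 - l) := pow_nonneg (pow_nonneg hρ0.le 4) _
            have := mul_le_mul_of_nonneg_left (mul_le_mul_of_nonneg_right hρ3 h4) (mul_nonneg hθ hΓ0)
            linarith
        _ = _ := by ring
    calc ∑ l ∈ Finset.range j, ρ ^ j * (ρ ^ (j - 1 - l) * (260 * (μ l * (C₁ * x l))))
        ≤ ∑ l ∈ Finset.range j, (θ * E * x₀ * ρ ^ (2 * k + 1) * (ρ ^ 2) ^ (j - 1 - l)
          + θ * (2 * (D * B + θ * E * (1 + D * C * (ρ / (1 - ρ))) * (E * x₀ * ρ ^ (2 * k + 1) / (1 - ρ ^ 2)))) * ρ ^ 3 * (ρ ^ 4) ^ (j - 1 - l)) :=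
          Finset.sum_le_sum hterm
      _ = θ * E * x₀ * ρ ^ (2 * k + 1) * ∑ l ∈ Finset.range j, (ρ ^ 2) ^ (j - 1 - l)
          + θ * (2 * (D * B + θ * E * (1 + D * C * (ρ / (1 - ρ))) * (E * x₀ * ρ ^ (2 * k + 1) / (1 - ρ ^ 2)))) * ρ ^ 3
            * ∑ l ∈ Finset.range j, (ρ ^ 4) ^ (j - 1 - l) := by
          rw [Finset.sum_add_distrib, ← Finset.mul_sum, ← Finset.mul_sum]
      _ ≤ θ * E * x₀ * ρ ^ (2 * k + 1) * (1 / (1 - ρ ^ 2))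
          + θ * (2 * (D * B + θ * E * (1 + D * C * (ρ / (1 - ρ))) * (E * x₀ * ρ ^ (2 * k + 1) / (1 - ρ ^ 2)))) * ρ ^ 3
            * (1 / (1 - ρ ^ 4)) :=
          add_le_add (mul_le_mul_of_nonneg_left (geom_sum_reflect_le (pow_nonneg hρ0.le 2) hρ2lt j) (by positivity))
            (mul_le_mul_of_nonneg_left (geom_sum_reflect_le (pow_nonneg hρ0.le 4) hρ4lt j) (by positivity))
      _ = _ := by ring
  -- ★ the level row after multiplication by `ρⁱ`: the source and gauge-sum parts
  have core : ∀ i ≤ k, (∀ l < i, ρ ^ l * x l ≤ E * ρ ^ (2 * l) * x₀ + 2 * (D * B + θ * E * (1 + D * C * (ρ / (1 - ρ))) * (E * x₀ * ρ ^ (2 * k + 1) / (1 - ρ ^ 2)))) →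
      e i * (ρ ^ i * S i) + D * (ρ ^ i * ∑ j ∈ Finset.range i, C * (e j * S j))
        ≤ θ * E * (1 + D * C * (ρ / (1 - ρ))) * (E * x₀ * ρ ^ (2 * k + 1) / (1 - ρ ^ 2))
          + θ * E * (1 + D * C * (ρ / (1 - ρ))) * (ρ ^ 3 / (1 - ρ ^ 4))
            * (2 * (D * B + θ * E * (1 + D * C * (ρ / (1 - ρ))) * (E * x₀ * ρ ^ (2 * k + 1) / (1 - ρ ^ 2)))) := by
    intro i hi IH
    -- `ρʲS_j` for every `j ≤ i`
    have hSj : ∀ j ≤ i, ρ ^ j * S j ≤ θ * (E * x₀ * ρ ^ (2 * k + 1) / (1 - ρ ^ 2)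
        + 2 * (D * B + θ * E * (1 + D * C * (ρ / (1 - ρ))) * (E * x₀ * ρ ^ (2 * k + 1) / (1 - ρ ^ 2))) * (ρ ^ 3 / (1 - ρ ^ 4))) :=
      fun j hj => key j (hj.trans hi) (fun l hl => IH l (lt_of_lt_of_le hl hj))
    have hT0 : 0 ≤ θ * (E * x₀ * ρ ^ (2 * k + 1) / (1 - ρ ^ 2)
        + 2 * (D * B + θ * E * (1 + D * C * (ρ / (1 - ρ))) * (E * x₀ * ρ ^ (2 * k + 1) / (1 - ρ ^ 2))) * (ρ ^ 3 / (1 - ρ ^ 4))) := by positivity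
    obtain ⟨hei0, heiE⟩ := he i hi
    -- the source part
    have hc : e i * (ρ ^ i * S i) ≤ E * (θ * (E * x₀ * ρ ^ (2 * k + 1) / (1 - ρ ^ 2)
        + 2 * (D * B + θ * E * (1 + D * C * (ρ / (1 - ρ))) * (E * x₀ * ρ ^ (2 * k + 1) / (1 - ρ ^ 2))) * (ρ ^ 3 / (1 - ρ ^ 4)))) :=
      mul_le_mul heiE (hSj i le_rfl) (mul_nonneg (pow_nonneg hρ0.le _) (hS0 i hi)) hE
    -- the gauge double sum
    have hd : ρ ^ i * ∑ j ∈ Finset.range i, C * (e j * S j) ≤ C * E * (θ * (E * x₀ * ρ ^ (2 * k + 1) / (1 - ρ ^ 2)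
        + 2 * (D * B + θ * E * (1 + D * C * (ρ / (1 - ρ))) * (E * x₀ * ρ ^ (2 * k + 1) / (1 - ρ ^ 2))) * (ρ ^ 3 / (1 - ρ ^ 4)))) * (ρ / (1 - ρ)) := by
      rw [Finset.mul_sum]
      have hterm : ∀ j ∈ Finset.range i, ρ ^ i * (C * (e j * S j)) ≤ C * E * (θ * (E * x₀ * ρ ^ (2 * k + 1) / (1 - ρ ^ 2)
          + 2 * (D * B + θ * E * (1 + D * C * (ρ / (1 - ρ))) * (E * x₀ * ρ ^ (2 * k + 1) / (1 - ρ ^ 2))) * (ρ ^ 3 / (1 - ρ ^ 4)))) * (ρ ^ (i - 1 - j) * ρ) := by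
        intro j hj
        have hji : j < i := Finset.mem_range.mp hj
        have epow : ρ ^ i = ρ ^ (i - 1 - j) * ρ * ρ ^ j := by
          rw [← pow_succ, ← pow_add]; congr 1; omega
        obtain ⟨hej0, hejE⟩ := he j (le_trans hji.le hi)
        have hSj' := hSj j hji.le
        have hS0' : 0 ≤ ρ ^ j * S j := mul_nonneg (pow_nonneg hρ0.le _) (hS0 j (le_trans hji.le hi))
        rw [epow]
        calc ρ ^ (i - 1 - j) * ρ * ρ ^ j * (C * (e j * S j)) = C * e j * (ρ ^ j * S j) * (ρ ^ (i - 1 - j) * ρ) := by ring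
          _ ≤ C * E * (θ * (E * x₀ * ρ ^ (2 * k + 1) / (1 - ρ ^ 2)
              + 2 * (D * B + θ * E * (1 + D * C * (ρ / (1 - ρ))) * (E * x₀ * ρ ^ (2 * k + 1) / (1 - ρ ^ 2))) * (ρ ^ 3 / (1 - ρ ^ 4)))) * (ρ ^ (i - 1 - j) * ρ) := by
              refine mul_le_mul_of_nonneg_right ?_ (mul_nonneg (pow_nonneg hρ0.le _) hρ0.le)
              exact mul_le_mul (mul_le_mul_of_nonneg_left hejE hC) hSj' hS0' (by positivity)
      calc ∑ j ∈ Finset.range i, ρ ^ i * (C * (e j * S j))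
          ≤ ∑ j ∈ Finset.range i, C * E * (θ * (E * x₀ * ρ ^ (2 * k + 1) / (1 - ρ ^ 2)
              + 2 * (D * B + θ * E * (1 + D * C * (ρ / (1 - ρ))) * (E * x₀ * ρ ^ (2 * k + 1) / (1 - ρ ^ 2))) * (ρ ^ 3 / (1 - ρ ^ 4)))) * (ρ ^ (i - 1 - j) * ρ) :=
            Finset.sum_le_sum hterm
        _ = C * E * (θ * (E * x₀ * ρ ^ (2 * k + 1) / (1 - ρ ^ 2)
              + 2 * (D * B + θ * E * (1 + D * C * (ρ / (1 - ρ))) * (E * x₀ * ρ ^ (2 * k + 1) / (1 - ρ ^ 2))) * (ρ ^ 3 / (1 - ρ ^ 4))))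
              * ((∑ j ∈ Finset.range i, ρ ^ (i - 1 - j)) * ρ) := by
            rw [← Finset.mul_sum, Finset.sum_mul]
        _ ≤ C * E * (θ * (E * x₀ * ρ ^ (2 * k + 1) / (1 - ρ ^ 2)
              + 2 * (D * B + θ * E * (1 + D * C * (ρ / (1 - ρ))) * (E * x₀ * ρ ^ (2 * k + 1) / (1 - ρ ^ 2))) * (ρ ^ 3 / (1 - ρ ^ 4)))) * ((1 / (1 - ρ)) * ρ) :=
            mul_le_mul_of_nonneg_left (mul_le_mul_of_nonneg_right (geom_sum_reflect_le hρ0.le hρ1 i) hρ0.le) (by positivity)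
        _ = _ := by ring
    have hdd := mul_le_mul_of_nonneg_left hd hD
    have e1 : E * (θ * (E * x₀ * ρ ^ (2 * k + 1) / (1 - ρ ^ 2)
        + 2 * (D * B + θ * E * (1 + D * C * (ρ / (1 - ρ))) * (E * x₀ * ρ ^ (2 * k + 1) / (1 - ρ ^ 2))) * (ρ ^ 3 / (1 - ρ ^ 4))))
        + D * (C * E * (θ * (E * x₀ * ρ ^ (2 * k + 1) / (1 - ρ ^ 2)
        + 2 * (D * B + θ * E * (1 + D * C * (ρ / (1 - ρ))) * (E * x₀ * ρ ^ (2 * k + 1) / (1 - ρ ^ 2))) * (ρ ^ 3 / (1 - ρ ^ 4)))) * (ρ / (1 - ρ)))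
        = θ * E * (1 + D * C * (ρ / (1 - ρ))) * (E * x₀ * ρ ^ (2 * k + 1) / (1 - ρ ^ 2))
          + θ * E * (1 + D * C * (ρ / (1 - ρ))) * (ρ ^ 3 / (1 - ρ ^ 4))
            * (2 * (D * B + θ * E * (1 + D * C * (ρ / (1 - ρ))) * (E * x₀ * ρ ^ (2 * k + 1) / (1 - ρ ^ 2)))) := by ring
    linarith [hc, hdd, e1]
  -- (1) by strong induction
  have main : ∀ i, i ≤ k → ρ ^ i * x i ≤ E * ρ ^ (2 * i) * x₀ + 2 * (D * B + θ * E * (1 + D * C * (ρ / (1 - ρ))) * (E * x₀ * ρ ^ (2 * k + 1) / (1 - ρ ^ 2))) := by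
    intro i
    induction i using Nat.strong_induction_on with
    | _ i IH =>
      intro hi
      have IH' : ∀ l < i, ρ ^ l * x l ≤ E * ρ ^ (2 * l) * x₀ + 2 * (D * B + θ * E * (1 + D * C * (ρ / (1 - ρ))) * (E * x₀ * ρ ^ (2 * k + 1) / (1 - ρ ^ 2))) :=
        fun l hl => IH l hl (le_trans hl.le hi)
      have hcore := core i hi IH'
      obtain ⟨hei0, heiE⟩ := he i hi
      obtain ⟨hl0, hlB⟩ := hlam i hi
      have hρi : 0 ≤ ρ ^ i := pow_nonneg hρ0.le i
      have hr' := mul_le_mul_of_nonneg_left (hrec i hi) hρi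
      have expand : ρ ^ i * (ρ ^ i * e i * x₀ + D * lam i + (e i * S i + D * ∑ j ∈ Finset.range i, C * (e j * S j)))
          = ρ ^ (2 * i) * e i * x₀ + D * (ρ ^ i * lam i) + (e i * (ρ ^ i * S i) + D * (ρ ^ i * ∑ j ∈ Finset.range i, C * (e j * S j))) := by
        rw [show ρ ^ (2 * i) = ρ ^ i * ρ ^ i by rw [← pow_add]; ring_nf]
        ring
      rw [expand] at hr'
      have ha : ρ ^ (2 * i) * e i * x₀ ≤ E * ρ ^ (2 * i) * x₀ := by
        have := mul_le_mul_of_nonneg_right (mul_le_mul_of_nonneg_left heiE (pow_nonneg hρ0.le (2 * i))) hx₀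
        linarith
      have hb : D * (ρ ^ i * lam i) ≤ D * B := mul_le_mul_of_nonneg_left hlB hD
      have hq : θ * E * (1 + D * C * (ρ / (1 - ρ))) * (ρ ^ 3 / (1 - ρ ^ 4))
            * (2 * (D * B + θ * E * (1 + D * C * (ρ / (1 - ρ))) * (E * x₀ * ρ ^ (2 * k + 1) / (1 - ρ ^ 2))))
          ≤ 1 / 2 * (2 * (D * B + θ * E * (1 + D * C * (ρ / (1 - ρ))) * (E * x₀ * ρ ^ (2 * k + 1) / (1 - ρ ^ 2)))) :=
        mul_le_mul_of_nonneg_right hsmall hΓ0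
      linarith [hr', ha, hb, hcore, hq]
  refine ⟨main, ?_⟩
  -- (2) at the top level
  have hcore := core k le_rfl (fun l hl => main l hl.le)
  have hq : θ * E * (1 + D * C * (ρ / (1 - ρ))) * (ρ ^ 3 / (1 - ρ ^ 4))
        * (2 * (D * B + θ * E * (1 + D * C * (ρ / (1 - ρ))) * (E * x₀ * ρ ^ (2 * k + 1) / (1 - ρ ^ 2))))
      ≤ 1 / 2 * (2 * (D * B + θ * E * (1 + D * C * (ρ / (1 - ρ))) * (E * x₀ * ρ ^ (2 * k + 1) / (1 - ρ ^ 2)))) :=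
    mul_le_mul_of_nonneg_right hsmall hΓ0
  have expand : ρ ^ k * (e k * S k + D * ∑ j ∈ Finset.range k, C * (e j * S j))
      = e k * (ρ ^ k * S k) + D * (ρ ^ k * ∑ j ∈ Finset.range k, C * (e j * S j)) := by ring
  rw [expand]
  linarith [hcore, hq]

end Summit.QuantumFields.YangMills.Theorems.Prop7FibreLevelMassInduction

end
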